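import Summits.RiemannHypothesis.RiemannHypothesis.Theorems.SuzukiStructureFunctionsWindowResolvent
import Summits.RiemannHypothesis.RiemannHypothesis.Theorems.SuzukiPhiFredholmWindows
import Literature.NumberTheory.LFunctions.SuzukiStructureFunctions

/-!
# SuzukiStructureFunctionsMuContinuity — Thm. 3.1 (2) of Suzuki JFA21, first part: on clean windows `φ^ε(t,x)` and
# `μ(t) = φ⁺(t,t) + φ⁻(t,t)` are continuous in `t`; on a clean range `m = exp∫₀ᵗμ` is continuous and `m′ = μm`
# (column DBR; RH-FREE)

LINE 1 — LABEL: RH-FREE (ζ-free operator theory for ANY continuous kernel vanishing on `(−∞,0]`, on its clean windows;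
no zeros, no positivity); bears_on LADDER-RH B-D → B-P(P1): DISCHARGES the conjunct `ContinuousOn (m K) (Ico 0 τ)` of
the declared residual `Literature.NumberTheory.LFunctions.SuzukiStructure.Suzuki2021_thm31_dynamics` (under (K2)–(K3)
continuity/support and (K5) on `[0,τ)`), and proves `m′ = μm` in the interior. WHAT THIS IS NOT: not progress toward
RH; the canonical system (Thm. 3.1 (4)) and the `t`-continuity of `A(t,z)`, `B(t,z)` remain in the residual.

Source: M. Suzuki, J. Funct. Anal. 281 (2021) 109116 = arXiv:1606.05726 [Suzuki2021Hamiltonians], Lemma 3.6 (first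
half: «`φ^ε(t,x)` is continuous on `[0,τ)` as a function of `t`»), §3.5 («`μ(t)` is continuous on `[0,τ)`»), (3.32)–(3.33)
(«`m(t)` is a continuous positive real-valued function on `[0,τ)`»). ROAD (not Suzuki's Fredholm minors (3.15)–(3.17)):
the window restriction of `φ^ε(t,·)` is `(1 + ε𝖪[t])⁻¹(𝟙_{[−t,t]}K(·+t))` on the FIXED space `L²(ℝ)`, and (3.7) becomes
an inner product of `t`-continuous `L²(ℝ)`-valued data with a `t`-continuous resolvent.

Contents (seat rh-dbr-eng-5 g7; continuation of `…WindowResolvent`):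
* `inverse_apply_rhs_eq_window_phi` — `(1 + ε𝖪[t])⁻¹(𝟙_{[−t,t]}K(·+t)) = 𝟙_{[−t,t]}φ^ε(t,·)` in `L²(ℝ)`;
* `suzukiPhiExt_eq_inner` — `φ^ε(t,x) = K(x+t) − ε⟪𝟙_{[−t,t]}K(x+·), (1 + ε𝖪[t])⁻¹ 𝟙_{[−t,t]}K(·+t)⟫`;
* **`continuousWithinAt_suzukiPhiExt_window`** — `s ↦ φ^ε(s,x)` continuous within the clean windows at each clean `t`;
* **`continuousOn_mu`**, `continuousOn_mu_Ico` — `μ` continuous on the clean windows / on a clean range `[0,τ)`;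
* **`continuousOn_m_Ico`** — `m` continuous on a clean range `[0,τ)`; **`hasDerivAt_m`** — `m′ = μ·m` on `(0,τ)`.
-/

noncomputable section

-- D-0017: `Summit.<S>.<S>.…` is the designed namespace of a single-problem summit.
set_option linter.dupNamespace false

open MeasureTheory Set Filter Topology Function
open scoped ENNReal RealInnerProductSpace

namespace Summit.RiemannHypothesis.RiemannHypothesis.Theorems.SuzukiStructureFunctions

open Literature.Analysis.OperatorTheory Literature.NumberTheory.LFunctions
  Literature.NumberTheory.LFunctions.SuzukiStructure
open Summit.RiemannHypothesis.RiemannHypothesis.Theorems.SuzukiPhiExistence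
  (continuous_suzukiPhiExt setIntegral_Iic_kernel_mul_suzukiPhiExt_eq exists_isSuzukiPhiSolution_of_noUnitEigenvalue)

variable {K : ℝ → ℝ} {ε t : ℝ}

/-! ## §17 Thm. 3.1 (2), first part: on a clean window `φ^ε(t,x)`, `μ(t)` are continuous in `t`, and
`m(t) = exp ∫₀ᵗ μ` is `C¹` with `m′ = μ·m` on clean ranges

Road (ζ-free, RH-free): on a clean window `1 + ε𝖪[t]` is a unit on `L²(ℝ)` (`isUnit_one_add_smul_winOpL2`); the
window restriction `u_t = 𝟙_{[−t,t]}φ^ε(t,·)` of Suzuki's extended solution satisfies `(1 + ε𝖪[t])u_t = 𝟙_{[−t,t]}K(·+t)`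
by (3.8), so `u_t = (1 + ε𝖪[t])⁻¹(𝟙_{[−t,t]}K(·+t))`, and (3.7) reads
`φ^ε(t,x) = K(x+t) − ε⟪𝟙_{[−t,t]}K(x+·), (1 + ε𝖪[t])⁻¹ 𝟙_{[−t,t]}K(·+t)⟫_{L²(ℝ)}` — every ingredient is continuous in `t`
(§15–§16). -/

/-- RH-FREE. Suzuki's right-hand side `𝟙_{[−t,t]}(y)K(y+t)` as data `G(t,y) = K(y+t)`: jointly continuous. -/
theorem continuous_uncurry_kernel_shift (hK : Continuous K) : Continuous (uncurry fun t y : ℝ => K (y + t)) :=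
  hK.comp (continuous_snd.add continuous_fst)

/-- RH-FREE. The row `y ↦ K(x+y)` (constant in `t`) as data: jointly continuous. -/
theorem continuous_uncurry_kernel_row (hK : Continuous K) (x : ℝ) : Continuous (uncurry fun _ y : ℝ => K (x + y)) :=
  hK.comp (continuous_const.add continuous_snd)

/-- RH-FREE. The diagonal row `y ↦ K(t+y)` as data `G(t,y) = K(t+y)`: jointly continuous. -/
theorem continuous_uncurry_kernel_diag (hK : Continuous K) : Continuous (uncurry fun t y : ℝ => K (t + y)) :=
  hK.comp (continuous_fst.add continuous_snd)

/-- RH-FREE. The window restriction `𝟙_{[−t,t]}φ^ε(t,·)` of the (continuous) extended solution is in `L²(ℝ)`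
(data `G(s,y) = φ^ε(t,y)`, constant in `s`). -/
theorem continuous_uncurry_suzukiPhiExt_const (hK : Continuous K) (hK3 : ∀ u : ℝ, u < 0 → K u = 0) (ε t : ℝ) :
    Continuous (uncurry fun _ y : ℝ => suzukiPhiExt K ε t y) :=
  (continuous_suzukiPhiExt hK hK3 ε t).comp continuous_snd

/-- **RH-FREE · the window restriction of `φ^ε(t,·)` IS the resolvent applied to Suzuki's right-hand side:** on a clean
window (`NoUnitEigenvalue K t`, `ε = ±1`, `K` continuous vanishing on `(−∞,0]`),
`(1 + ε𝖪[t])⁻¹(𝟙_{[−t,t]}K(·+t)) = 𝟙_{[−t,t]}φ^ε(t,·)` in `L²(ℝ)` (from (3.8) and the invertibility of `1 + ε𝖪[t]`). -/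
theorem inverse_apply_rhs_eq_window_phi (hK : Continuous K) (hK0 : ∀ u : ℝ, u ≤ 0 → K u = 0) (hε : ε = 1 ∨ ε = -1)
    (hN : NoUnitEigenvalue K t) :
    Ring.inverse (1 + ε • winOpL2 K hK t) ((memLp_indicator_window (continuous_uncurry_kernel_shift hK) t).toLp _) =
      (memLp_indicator_window (continuous_uncurry_suzukiPhiExt_const hK (fun u hu => hK0 u hu.le) ε t) t).toLp _ := by
  have hK3 : ∀ u : ℝ, u < 0 → K u = 0 := fun u hu => hK0 u hu.le
  set A := winOpL2 K hK t with hA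
  set U : Lp ℝ 2 (volume : Measure ℝ) →L[ℝ] Lp ℝ 2 (volume : Measure ℝ) := 1 + ε • A with hU
  have hUu : IsUnit U := isUnit_one_add_smul_winOpL2 hK hε hN
  set φ := suzukiPhiExt K ε t with hφ
  have hsol : ∃ X : ℝ → ℝ, IsSuzukiPhiSolution K ε t X := exists_isSuzukiPhiSolution_of_noUnitEigenvalue hK hK0 hε hN
  set u : Lp ℝ 2 (volume : Measure ℝ) :=
    (memLp_indicator_window (continuous_uncurry_suzukiPhiExt_const hK hK3 ε t) t).toLp _ with hu
  set k : Lp ℝ 2 (volume : Measure ℝ) := (memLp_indicator_window (continuous_uncurry_kernel_shift hK) t).toLp _ with hk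
  have hu_ae : (u : ℝ → ℝ) =ᵐ[volume] fun y => (Icc (-t) t).indicator (fun y => φ y) y := MemLp.coeFn_toLp _
  have hk_ae : (k : ℝ → ℝ) =ᵐ[volume] fun y => (Icc (-t) t).indicator (fun y => K (y + t)) y := MemLp.coeFn_toLp _
  -- `U u = k`
  have hUk : U u = k := by
    apply Lp.ext
    have h1 : ((U u : Lp ℝ 2 (volume : Measure ℝ)) : ℝ → ℝ) =ᵐ[volume] fun x => u x + ε * (A u) x := by
      have e : U u = u + ε • A u := by
        simp [hU]
      rw [e]
      filter_upwards [Lp.coeFn_add u (ε • A u), Lp.coeFn_smul ε (A u)] with x hx1 hx2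
      rw [hx1, Pi.add_apply, hx2, Pi.smul_apply, smul_eq_mul]
    have h2 := winOpL2_spec hK t u
    filter_upwards [h1, h2, hu_ae, hk_ae] with x e1 e2 e3 e4
    rw [e1, e2, e4]
    -- replace the representative of `u` inside the integral
    have hint : ∫ y, winKer K t x y * (u : ℝ → ℝ) y = ∫ y, winKer K t x y * (Icc (-t) t).indicator (fun y => φ y) y :=
      integral_congr_ae (by filter_upwards [hu_ae] with y hy; rw [hy])
    rw [hint]
    by_cases hx : x ∈ Icc (-t) t
    · rw [e3, indicator_of_mem hx, indicator_of_mem hx, integral_winKer_mul_eq_setIntegral K hx]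
      have hIoo : ∫ y in Ioo (-t) t, K (x + y) * (Icc (-t) t).indicator (fun y => φ y) y =
          ∫ y in Ioo (-t) t, K (x + y) * φ y :=
        setIntegral_congr_fun measurableSet_Ioo fun y hy => by rw [indicator_of_mem (Ioo_subset_Icc_self hy)]
      rw [hIoo, ← setIntegral_Iic_kernel_mul_suzukiPhiExt_eq hK3 ε t x]
      have h38 := suzukiPhiExt_eq hsol x
      rw [← hφ] at h38
      linarith
    · rw [e3, indicator_of_notMem hx, indicator_of_notMem hx, integral_winKer_mul_eq_zero K hx]
      ring
  -- apply the inverse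
  calc Ring.inverse U k = Ring.inverse U (U u) := by rw [hUk]
    _ = (Ring.inverse U * U) u := rfl
    _ = u := by rw [Ring.inverse_mul_cancel U hUu]; rfl

/-- **RH-FREE · (3.7) THROUGH THE RESOLVENT:** on a clean window, for every real `x`,
`φ^ε(t,x) = K(x+t) − ε⟪𝟙_{[−t,t]}K(x+·), (1 + ε𝖪[t])⁻¹(𝟙_{[−t,t]}K(·+t))⟫_{L²(ℝ)}`. -/
theorem suzukiPhiExt_eq_inner (hK : Continuous K) (hK0 : ∀ u : ℝ, u ≤ 0 → K u = 0) (hε : ε = 1 ∨ ε = -1)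
    (hN : NoUnitEigenvalue K t) (x : ℝ) :
    suzukiPhiExt K ε t x = K (x + t) - ε *
      ⟪(memLp_indicator_window (continuous_uncurry_kernel_row hK x) t).toLp _,
        Ring.inverse (1 + ε • winOpL2 K hK t)
          ((memLp_indicator_window (continuous_uncurry_kernel_shift hK) t).toLp _)⟫ := by
  have hK3 : ∀ u : ℝ, u < 0 → K u = 0 := fun u hu => hK0 u hu.le
  have hsol : ∃ X : ℝ → ℝ, IsSuzukiPhiSolution K ε t X := exists_isSuzukiPhiSolution_of_noUnitEigenvalue hK hK0 hε hN
  rw [inverse_apply_rhs_eq_window_phi hK hK0 hε hN]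
  set u : Lp ℝ 2 (volume : Measure ℝ) :=
    (memLp_indicator_window (continuous_uncurry_suzukiPhiExt_const hK hK3 ε t) t).toLp _ with hu
  have hu_ae : (u : ℝ → ℝ) =ᵐ[volume] fun y => (Icc (-t) t).indicator (fun y => suzukiPhiExt K ε t y) y :=
    MemLp.coeFn_toLp _
  have hg : MemLp (fun y : ℝ => (Icc (-t) t).indicator (fun y => K (x + y)) y) 2 (volume : Measure ℝ) :=
    memLp_indicator_window (continuous_uncurry_kernel_row hK x) t
  -- the inner product as an integral
  have hinner := integral_l2Kernel_mul_eq_inner (K := fun _ y : ℝ => (Icc (-t) t).indicator (fun y => K (x + y)) y)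
    (x := x) hg u
  rw [← hinner]
  have hint : ∫ y, (Icc (-t) t).indicator (fun y => K (x + y)) y * (u : ℝ → ℝ) y =
      ∫ y in Ioo (-t) t, K (x + y) * suzukiPhiExt K ε t y := by
    rw [← setIntegral_congr_set (Ioo_ae_eq_Icc (μ := (volume : Measure ℝ))).symm, ← integral_indicator measurableSet_Icc]
    refine integral_congr_ae ?_
    filter_upwards [hu_ae] with y hy
    rw [hy]
    by_cases hyI : y ∈ Icc (-t) t
    · rw [indicator_of_mem hyI, indicator_of_mem hyI, indicator_of_mem hyI]
    · rw [indicator_of_notMem hyI, indicator_of_notMem hyI, zero_mul, indicator_of_notMem hyI]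
  rw [hint, ← setIntegral_Iic_kernel_mul_suzukiPhiExt_eq hK3 ε t x]
  exact suzukiPhiExt_eq hsol x

/-- **RH-FREE · CONTINUITY OF `φ^ε(t,x)` IN `t` ON CLEAN WINDOWS** (Thm. 3.1 (2), Lemma 3.6 first half: «`φ^ε(t,x)` is
continuous on `[0,τ)` as a function of `t`»): at a clean window `t ≥ 0` and within the set of clean windows `s ≥ 0`,
`s ↦ φ^ε(s,x)` is continuous, for every real `x`. -/
theorem continuousWithinAt_suzukiPhiExt_window (hK : Continuous K) (hK0 : ∀ u : ℝ, u ≤ 0 → K u = 0)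
    (hε : ε = 1 ∨ ε = -1) (ht : 0 ≤ t) (hN : NoUnitEigenvalue K t) (x : ℝ) :
    ContinuousWithinAt (fun s : ℝ => suzukiPhiExt K ε s x) {s : ℝ | 0 ≤ s ∧ NoUnitEigenvalue K s} t := by
  set S : Set ℝ := {s : ℝ | 0 ≤ s ∧ NoUnitEigenvalue K s} with hS
  have hSsub : S ⊆ Ici 0 := fun s hs => hs.1
  have hformula : ∀ s ∈ S, suzukiPhiExt K ε s x = K (x + s) - ε *
      ⟪(memLp_indicator_window (continuous_uncurry_kernel_row hK x) s).toLp _,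
        Ring.inverse (1 + ε • winOpL2 K hK s)
          ((memLp_indicator_window (continuous_uncurry_kernel_shift hK) s).toLp _)⟫ :=
    fun s hs => suzukiPhiExt_eq_inner hK hK0 hε hs.2 x
  have hcont : ContinuousWithinAt (fun s : ℝ => K (x + s) - ε *
      ⟪(memLp_indicator_window (continuous_uncurry_kernel_row hK x) s).toLp _,
        Ring.inverse (1 + ε • winOpL2 K hK s)
          ((memLp_indicator_window (continuous_uncurry_kernel_shift hK) s).toLp _)⟫) (Ici 0) t := by
    have h1 : ContinuousWithinAt (fun s : ℝ => K (x + s)) (Ici 0) t :=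
      ((hK.comp (continuous_const.add continuous_id)).continuousAt).continuousWithinAt
    have h2 := (continuousOn_toLp_indicator_window (continuous_uncurry_kernel_row hK x)) t ht
    have h3 := (continuousOn_toLp_indicator_window (continuous_uncurry_kernel_shift hK)) t ht
    have h4 := continuousWithinAt_inverse_winOpL2 hK hε ht hN
    have h5 := h4.clm_apply h3
    exact h1.sub ((h2.inner h5).const_smul ε |>.congr (fun s _ => by simp [smul_eq_mul]) (by simp [smul_eq_mul]))
  exact (hcont.mono hSsub).congr (fun s hs => hformula s hs) (hformula t ⟨ht, hN⟩)

/-- **RH-FREE · `μ(t) = φ⁺(t,t) + φ⁻(t,t)` IS CONTINUOUS ON THE CLEAN WINDOWS** (the continuity clause for `μ` in §3.5: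
«`μ(t)` is continuous on `[0,τ)`»): `ContinuousOn μ {t ≥ 0 : NoUnitEigenvalue K t}`. -/
theorem continuousOn_mu (hK : Continuous K) (hK0 : ∀ u : ℝ, u ≤ 0 → K u = 0) :
    ContinuousOn (mu K) {s : ℝ | 0 ≤ s ∧ NoUnitEigenvalue K s} := by
  intro t ht
  set S : Set ℝ := {s : ℝ | 0 ≤ s ∧ NoUnitEigenvalue K s} with hS
  have hSsub : S ⊆ Ici 0 := fun s hs => hs.1
  -- the diagonal formula for `φ^ε(s,s)`
  have hdiag : ∀ ε : ℝ, (ε = 1 ∨ ε = -1) → ContinuousWithinAt (fun s : ℝ => suzukiPhiExt K ε s s) S t := by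
    intro ε hε
    have hformula : ∀ s ∈ S, suzukiPhiExt K ε s s = K (s + s) - ε *
        ⟪(memLp_indicator_window (continuous_uncurry_kernel_diag hK) s).toLp _,
          Ring.inverse (1 + ε • winOpL2 K hK s)
            ((memLp_indicator_window (continuous_uncurry_kernel_shift hK) s).toLp _)⟫ :=
      fun s hs => suzukiPhiExt_eq_inner hK hK0 hε hs.2 s
    have hcont : ContinuousWithinAt (fun s : ℝ => K (s + s) - ε *
        ⟪(memLp_indicator_window (continuous_uncurry_kernel_diag hK) s).toLp _,
          Ring.inverse (1 + ε • winOpL2 K hK s)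
            ((memLp_indicator_window (continuous_uncurry_kernel_shift hK) s).toLp _)⟫) (Ici 0) t := by
      have h1 : ContinuousWithinAt (fun s : ℝ => K (s + s)) (Ici 0) t :=
        ((hK.comp (continuous_id.add continuous_id)).continuousAt).continuousWithinAt
      have h2 := (continuousOn_toLp_indicator_window (continuous_uncurry_kernel_diag hK)) t ht.1
      have h3 := (continuousOn_toLp_indicator_window (continuous_uncurry_kernel_shift hK)) t ht.1
      have h4 := continuousWithinAt_inverse_winOpL2 hK hε ht.1 ht.2
      have h5 := h4.clm_apply h3
      exact h1.sub ((h2.inner h5).const_smul ε |>.congr (fun s _ => by simp [smul_eq_mul]) (by simp [smul_eq_mul]))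
    exact (hcont.mono hSsub).congr (fun s hs => hformula s hs) (hformula t ht)
  have e : mu K = fun s => suzukiPhiExt K 1 s s + suzukiPhiExt K (-1) s s := by funext s; rfl
  rw [e]
  exact (hdiag 1 (Or.inl rfl)).add (hdiag (-1) (Or.inr rfl))

/-- RH-FREE. On a clean RANGE `[0,τ)`, `μ` is continuous on `[0,τ)`. -/
theorem continuousOn_mu_Ico (hK : Continuous K) (hK0 : ∀ u : ℝ, u ≤ 0 → K u = 0) {τ : ℝ}
    (hclean : ∀ s : ℝ, s ∈ Ico 0 τ → NoUnitEigenvalue K s) : ContinuousOn (mu K) (Ico 0 τ) :=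
  (continuousOn_mu hK hK0).mono fun s hs => ⟨hs.1, hclean s hs⟩

/-- **RH-FREE · THM. 3.1 (2) for `m`: on a clean range `[0,τ)`, `m(t) = exp ∫₀ᵗ μ` is continuous on `[0,τ)`** — the
conjunct `ContinuousOn (m K) (Ico 0 τ)` of the declared residual `Suzuki2021_thm31_dynamics`, DISCHARGED under
(K2)–(K3) continuity/support and (K5) on `[0,τ)`. -/
theorem continuousOn_m_Ico (hK : Continuous K) (hK0 : ∀ u : ℝ, u ≤ 0 → K u = 0) {τ : ℝ}
    (hclean : ∀ s : ℝ, s ∈ Ico 0 τ → NoUnitEigenvalue K s) : ContinuousOn (m K) (Ico 0 τ) := by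
  have hμ := continuousOn_mu_Ico hK hK0 hclean
  have hprim : ContinuousOn (fun t : ℝ => ∫ s in (0:ℝ)..t, mu K s) (Ico 0 τ) := by
    intro t ht
    -- work on `[0, T]` with `t < T < τ`
    set T : ℝ := (t + τ) / 2 with hT
    have htT : t < T := by rw [hT]; linarith [ht.2]
    have hTτ : T < τ := by rw [hT]; linarith [ht.2]
    have hint : IntegrableOn (mu K) (uIcc 0 T) volume := by
      rw [uIcc_of_le (by linarith [ht.1] : (0:ℝ) ≤ T)]
      exact (hμ.mono fun s hs => ⟨hs.1, lt_of_le_of_lt hs.2 hTτ⟩).integrableOn_compact isCompact_Icc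
    have hc := (intervalIntegral.continuousOn_primitive_interval (μ := volume) hint) t
      (by rw [uIcc_of_le (by linarith [ht.1] : (0:ℝ) ≤ T)]; exact ⟨ht.1, htT.le⟩)
    refine (hc.mono_of_mem_nhdsWithin ?_).mono_left (nhdsWithin_mono _ fun s hs => hs)
    · rw [uIcc_of_le (by linarith [ht.1] : (0:ℝ) ≤ T)]
      exact mem_nhdsWithin.2 ⟨Iio T, isOpen_Iio, htT, fun s hs => ⟨hs.2.1, le_of_lt hs.1⟩⟩
  have e : m K = fun t => Real.exp (∫ s in (0:ℝ)..t, mu K s) := by funext t; rfl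
  rw [e]
  exact Real.continuous_exp.comp_continuousOn hprim

/-- **RH-FREE · `m′ = μ·m` in the interior of a clean range** ((3.32) differentiated: at every `0 < t < τ`,
`HasDerivAt m (μ(t)m(t)) t`; in particular `m` is `C¹` where `μ` is continuous). -/
theorem hasDerivAt_m (hK : Continuous K) (hK0 : ∀ u : ℝ, u ≤ 0 → K u = 0) {τ : ℝ}
    (hclean : ∀ s : ℝ, s ∈ Ico 0 τ → NoUnitEigenvalue K s) (ht : t ∈ Ioo 0 τ) :
    HasDerivAt (m K) (mu K t * m K t) t := by
  have hμ := continuousOn_mu_Ico hK hK0 hclean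
  have hnhds : Ico 0 τ ∈ 𝓝 t := mem_of_superset (Ioo_mem_nhds ht.1 ht.2) Ioo_subset_Ico_self
  have hct : ContinuousAt (mu K) t := hμ.continuousAt hnhds
  have hint : IntervalIntegrable (mu K) volume 0 t := by
    refine ContinuousOn.intervalIntegrable ?_
    rw [uIcc_of_le ht.1.le]
    exact hμ.mono fun s hs => ⟨hs.1, lt_of_le_of_lt hs.2 ht.2⟩
  have hmeas : StronglyMeasurableAtFilter (mu K) (𝓝 t) volume :=
    ContinuousOn.stronglyMeasurableAtFilter isOpen_Ioo (hμ.mono Ioo_subset_Ico_self) t ht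
  have hF : HasDerivAt (fun u : ℝ => ∫ s in (0:ℝ)..u, mu K s) (mu K t) t :=
    intervalIntegral.integral_hasDerivAt_right hint hmeas hct
  have e : m K = fun u => Real.exp (∫ s in (0:ℝ)..u, mu K s) := by funext u; rfl
  rw [e]
  have h := (Real.hasDerivAt_exp (∫ s in (0:ℝ)..t, mu K s)).comp t hF
  have e2 : Real.exp (∫ s in (0:ℝ)..t, mu K s) * mu K t = mu K t * Real.exp (∫ s in (0:ℝ)..t, mu K s) := by ring
  rw [e2] at h
  exact h

end Summit.RiemannHypothesis.RiemannHypothesis.Theorems.SuzukiStructureFunctions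

end
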